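import Summits.ValiantsHypothesis.ValiantsHypothesis.Theorems.GrenetZeonDualUnipotentThreeHalvesHeavyTopLevelOneSubspace
import Summits.ValiantsHypothesis.ValiantsHypothesis.Theorems.GrenetZeonDualUnipotentThreeHalvesHeavyTopLevelTwo

/-!
# `GrenetZeon.DualUnipotentThreeHalves` (stmt-ValiantsHypothesis-24318), R2 heavy-top instrument — P-Q1, THE THEOREM:
# a codimension-one nilpotent subspace of `M_{s+1}(ℂ)` of generic type `(s,1)` is REDUCIBLE (`s ≥ 3`)

Experiment cell «val-heavytop-census» (D-0160), engine seat val-htc-eng-2 g3 (kernel-only lane; P-Q1 = kernel port of lead-g2's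
`Q1-PROOF.md`, eng lineage eng-1 g3 / eng-2 g3).  This file closes the port:

★★★ `not_irreducible_of_codimOne_typeS1` — let `s ≥ 3` and `V ≤ M_{s+1}(ℂ)` be a linear space with `Z^s = 0` for every `Z ∈ V`, containing some
`Z₀` with `Z₀^{s−1} ≠ 0` (generic Jordan type `(s,1)`), of dimension `C(s+1,2) − 1` (one less than Gerstenhaber's maximum).  Then `V` has a
non-trivial proper invariant subspace.

Assembly (port map `CENSUS-PQ1-PORTMAP-eng2g3.md`): eng-1 g3's ✓ `HeavyTopLevelTwo.not_irreducible_of_type_of_levelOne` (Jordan form ✓ `HeavyTopJordanShift`,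
conjugation transport, Level 2 = ✓ `HeavyTopLevelTwoLifts.lifts` (this seat) + ✓ `HeavyTopLevelTwoFinal` (eng-1 g3: (E1)/(E2) identities ⇒ exact lifts ⇒
common kernel `e₀`)) takes LEVEL 1 as a hypothesis `hL1`; ✓ `HeavyTopLevelOneSubspace.level_one_of_subspace` (this seat: torus-initial subspace
✓ `HeavyTopTorusInitial`, envelope ✓ `HeavyTopBorderEnvelope`, border orthogonality ✓ `HeavyTopBorderOrthogonality`, Gerstenhaber-with-shift
✓ `HeavyTopStrictUpperOfJordan`, path counts ✓ `HeavyTopBorderPathCount` (eng-1 g3), assembled in ✓ `HeavyTopLevelOne.level_one`) discharges it.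

Reading for the census (GRID.md, PREREG Q-items): at `s + 1 = 7` this is lead-g2's Q1 THEOREM — no 20-dimensional nilpotent subspace of `M₇(ℂ)` of
generic type `(6,1)` is irreducible; it is ONE of the inputs of `ι(7) ≤ 19` (the other types need Theorem C(7) + the MMS classification, not
ported).  Honest framing: a theorem about nilpotent matrix spaces; nothing here proves or refutes `HeavyTopLaw`/`HeavyTopSlowLaw`, 24318, S3 or
8062; `VP ≠ VNP` is NOT proved.  No definitions.  [lead-g2 `Q1-PROOF.md`; this cell]
-/

noncomputable section

-- single-conjunct layout: Sub = Summit, duplicated namespace component intended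
set_option linter.dupNamespace false

namespace Summit.ValiantsHypothesis.ValiantsHypothesis.Theorems.GrenetZeon.HeavyTopCodimOneReducible

open Matrix
open Summit.ValiantsHypothesis.ValiantsHypothesis.Theorems.GrenetZeon.HeavyTopLevelOneSubspace (level_one_of_subspace)
open Summit.ValiantsHypothesis.ValiantsHypothesis.Theorems.GrenetZeon.HeavyTopLevelTwo (not_irreducible_of_type_of_levelOne)

/-- ★★★ **Q1 THEOREM (P-Q1 closed).**  For `s ≥ 3`: a linear space `V ≤ M_{s+1}(ℂ)` with `Z^s = 0` on `V`, some `Z₀ ∈ V` with `Z₀^{s−1} ≠ 0`, and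
`dim V = C(s+1,2) − 1` is reducible — it has a non-trivial proper invariant subspace. [lead-g2 `Q1-PROOF.md`; this cell] -/
theorem not_irreducible_of_codimOne_typeS1 {s : ℕ} (hs : 3 ≤ s) (V : Submodule ℂ (Matrix (Fin (s + 1)) (Fin (s + 1)) ℂ))
    (hV : ∀ Z ∈ V, Z ^ s = 0) (Z₀ : Matrix (Fin (s + 1)) (Fin (s + 1)) ℂ) (hZ₀ : Z₀ ∈ V) (hZ₀' : Z₀ ^ (s - 1) ≠ 0)
    (hdim : Module.finrank ℂ V = (s + 1).choose 2 - 1) :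
    ¬ ∀ U : Submodule ℂ (Fin (s + 1) → ℂ), (∀ Z ∈ V, ∀ x ∈ U, Z *ᵥ x ∈ U) → U = ⊥ ∨ U = ⊤ := by
  refine not_irreducible_of_type_of_levelOne hs V hV Z₀ hZ₀ hZ₀' fun V' hV' hAV' hfin' => ?_
  obtain ⟨W, hfinW, _hgr, hinit, _hpow, _hAW, c, hc, hshape⟩ :=
    level_one_of_subspace hs (Matrix.of fun i j : Fin (s + 1) => if (j : ℕ) = i + 1 ∧ (j : ℕ) < s then (1 : ℂ) else 0)
      (fun _ _ => rfl) V' hV' hAV' (hfin'.trans hdim)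
  exact ⟨W, c, hfinW, hinit, hc, hshape⟩

/-- **The census instance `s + 1 = 7`** (lead-g2's Q1 THEOREM as used by the `(5,7)` analysis): a `20`-dimensional space `V ≤ M₇(ℂ)` with
`Z^6 = 0` on `V` and some `Z₀^5 ≠ 0` is reducible. [this cell] -/
theorem not_irreducible_seven_twenty (V : Submodule ℂ (Matrix (Fin 7) (Fin 7) ℂ)) (hV : ∀ Z ∈ V, Z ^ 6 = 0)
    (Z₀ : Matrix (Fin 7) (Fin 7) ℂ) (hZ₀ : Z₀ ∈ V) (hZ₀' : Z₀ ^ 5 ≠ 0) (hdim : Module.finrank ℂ V = 20) :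
    ¬ ∀ U : Submodule ℂ (Fin 7 → ℂ), (∀ Z ∈ V, ∀ x ∈ U, Z *ᵥ x ∈ U) → U = ⊥ ∨ U = ⊤ :=
  not_irreducible_of_codimOne_typeS1 (s := 6) (by norm_num) V hV Z₀ hZ₀ hZ₀' (by rw [hdim]; decide)


/-- **Contrapositive, the shape the census uses** (`ι(s+1) ≤ C(s+1,2) − 2` splits by Jordan type): an IRREDUCIBLE nilpotent space
`V ≤ M_{s+1}(ℂ)` (`s ≥ 3`) of dimension `C(s+1,2) − 1` either contains an element with `Z^s ≠ 0` (for a nilpotent space: a regular nilpotent, type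
`(s+1)` — Theorem C territory) or has nil-index at most `s − 1` (every `Z^{s−1} = 0` — MMS territory); the generic type `(s,1)` is excluded by
`not_irreducible_of_codimOne_typeS1`.  (Nilpotency of `V` is not even needed for the dichotomy as stated.) [this cell] -/
theorem exists_regular_or_index_le_of_irreducible {s : ℕ} (hs : 3 ≤ s) (V : Submodule ℂ (Matrix (Fin (s + 1)) (Fin (s + 1)) ℂ))
    (hdim : Module.finrank ℂ V = (s + 1).choose 2 - 1)
    (hirr : ∀ U : Submodule ℂ (Fin (s + 1) → ℂ), (∀ Z ∈ V, ∀ x ∈ U, Z *ᵥ x ∈ U) → U = ⊥ ∨ U = ⊤) :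
    (∃ Z ∈ V, Z ^ s ≠ 0) ∨ ∀ Z ∈ V, Z ^ (s - 1) = 0 := by
  by_contra h
  rw [not_or, not_exists, not_forall] at h
  obtain ⟨h1, h2⟩ := h
  obtain ⟨Z₀, hZ₀⟩ := h2
  rw [Classical.not_imp] at hZ₀
  have hV : ∀ Z ∈ V, Z ^ s = 0 := fun Z hZ => by
    have := h1 Z
    rw [not_and, not_not] at this
    exact this hZ
  exact not_irreducible_of_codimOne_typeS1 hs V hV Z₀ hZ₀.1 hZ₀.2 hdim hirr

/-- **Census instance `M₇`, contrapositive form**: an irreducible `20`-dimensional nilpotent subspace of `M₇(ℂ)` (the object `ι(7) ≤ 19` denies) would have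
to contain an element with `Z^6 ≠ 0` (a regular nilpotent) or satisfy `Z^5 = 0` throughout. [this cell] -/
theorem exists_regular_or_index_le_seven_twenty (V : Submodule ℂ (Matrix (Fin 7) (Fin 7) ℂ)) (hdim : Module.finrank ℂ V = 20)
    (hirr : ∀ U : Submodule ℂ (Fin 7 → ℂ), (∀ Z ∈ V, ∀ x ∈ U, Z *ᵥ x ∈ U) → U = ⊥ ∨ U = ⊤) :
    (∃ Z ∈ V, Z ^ 6 ≠ 0) ∨ ∀ Z ∈ V, Z ^ 5 = 0 :=
  exists_regular_or_index_le_of_irreducible (s := 6) (by norm_num) V (by rw [hdim]; decide) hirr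

end Summit.ValiantsHypothesis.ValiantsHypothesis.Theorems.GrenetZeon.HeavyTopCodimOneReducible

end
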